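import Summits.QuantumFields.YangMills.Theorems.BalabanUVNodesN07PointFeasibilityOneLevelFourier
import HarnessLib

/-!
# DAG node N07 [B11], road R0′ — LEMMA (P) ONE LEVEL, file 2∕3: the centre-sampling symbol
# `K(p′) = Σ_l e^{i(p′+l)·ηc₀}·conj u(p′+l)∕Δ(p′+l)²` is a POSITIVE REAL for `p′ ≠ 0` (odd `n`) — collapse to the support of `p′`, signed
# representatives re-indexed to `(0,2π)`, and dag-n07-w7's `aliasSymbolK_pos` BY NAME

Cell `pub-ymgap` (HUMAN RULINGS D-0062 ∕ D-0149 ∕ D-0154), width seat `pub-ymgap-dag-n07-w5` g0′, 2026-08-28.  `--kind proof --supports <K1 key> --as helper`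
(count-neutral; CLAIM-1 cell bus 08:40Z, lane owner GO 08:46Z).  Steps 3–4 bookkeeping of dag-n07-e's `LOCATED-POINT-FEASIBILITY.md` (the analytic core
«K(θ) > 0» is dag-n07-w7's p613440∕p614581 and is only CONSUMED here).

THE PRINT.  [B5] = T. Bałaban, *Propagators and renormalization transformations for lattice gauge theories. I*, Commun. Math. Phys. **95** (1984)
17–40 `[Balaban1984PropagatorsI]`: (1.6) p. 18 (blocks), (1.20) p. 20 (`Q′_k`), (1.29)–(1.31) p. 23 («p = p′ + l», `u_k(p) = Π_μ ∂¹_μ(p′)∕∂_μ(p)`,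
«u_k(l) = 0 for l ≠ 0»), p. 25 («R … an orthogonal projection on the linear subspace ΔN(Q′_k)»), (1.69)–(1.70) pp. 29–30; [B6] = CMP **96**
(1984) 223–250 `[Balaban1984PropagatorsII]`, (2.10)–(2.12) p. 225, (2.22) p. 226, (2.35) p. 228 («The only assumption we have used was the
positivity of the operator Δ_a»); [I] = CMP **109** (1987) 249–301 `[Balaban1987RG1]`, (0.4) p. 253 (the averaging of record: block CENTRES, odd `L`).

WHY (road R0′ of record, dag-n07-e `LOCATED-POINT-FEASIBILITY.md`, 2026-08-28).  At the record the (0.4) average intertwines fine gradients with the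
coarse gradient of the CENTRE VALUES (`Q_j(1)(∂φ) = ∂_c(φ∘embIter j)`), not with the block means behind `R`; the feasibility of the admissible pure gauge
on road R0′ (`N07FlatHFeasibility.exists_admissible_grad_of_flatKernel`, hypothesis `hker`) is then the lattice lemma
(P) «μ constant on the block centres ∧ R∂*∂μ = 0 ⇒ ∂μ = 0», which print's matched letters never need ([B6] (2.22) is about block means).

WHAT THIS FILE DOES.
* §3 (pure real bookkeeping) `sum_collapse` (a full alias sum over `[0,n)^d` whose off-support factors are `δ_{l_ν,0}` collapses to the support `J`),
  `phi1_periodic` ∕ `phi2_periodic` (both summand pieces are `2πn`-periodic; the first uses ODD `n`), ★ `sum_reindex` (signed representatives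
  `p′_ν ∈ [−π,π]` → `θ_ν ∈ (0,2π)` by a coordinatewise `finRotate`), ★★ `signed_alias_sum_pos` (`= n⁻⁴ × aliasSymbolK(θ) > 0`).
* §4 `factor_eq_real` (the three cases of file 1's §2 in one `if`), ★ `summand_eq_real` (the complex summand of `K(p′)` is the cast of an explicit real),
  ★★★ `centreSymbol_ne_zero` (`p′ ≠ 0 ⇒ K(p′) ≠ 0`).

HONEST FRAMING (binding).  Count-neutral helper typed on the b05 owner's torus `Tor (fine n M)` (carrier FN), ONE averaging level (block side `n` odd,
true centres `ny + c₀`, `2c₀ + 1 = n`), every `d`, every unit torus `M`; finite Fourier analysis + trigonometry only.  It asserts NOTHING of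
[B11]∕[B6]∕[3]'s analysis; the MULTI-LEVEL lemma `(P)_D` for a nested family `D` (the record's heart family `Node00.cubeDomains`) is NOT proved
here and remains OPEN (dag-n07-w7's `LOCATED-PD-TILE-CRITERION.md` holds the located evidence); under road (a) of the K0 lineage (k0-s1-w1) `(P)` is
not consumed — this is located-research insurance for the R0′-native junction.  The V1 ∕ record reading needs r03's transports
(`B6ProjR212TorusBridge.RE_bridge` for `R`, `B5Eq147TorusBridge.Lap_tS` ∕ `B5HkOpLandauMin.LapS_towerE` for `Δ`, and the images of the centres) and is
NOT in this file.  `hker` ∕ stub 1 ∕ K0⁷ ∕ K1⁸ NOT closed; N07 NOT discharged; counts unmoved; no summit statement is proved by this seat — R4 closes the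
conditional finite-𝕋⁴ rung `BalabanLadder.UV` only; nothing continuum ∕ ℝ⁴ ∕ OS ∕ mass gap ∕ Clay.  No `sorry`, no `def`, no `instance`, no `notation`.
-/

noncomputable section

open scoped BigOperators Matrix ComplexConjugate
open Finset Complex

namespace Summit.QuantumFields.YangMills.BalabanUVNodes.N07PointFeasibilityOneLevel

open Literature.MathematicalPhysics.QuantumFieldTheory.Balaban1983to89
open B5Prop11Plancherel (Tor chi dft fine sOf chi_add_right chi_zero_left sum_chi conj_chi)
open B5Block118 (cT dft_apply' conj_dft dft_inversion sum_conj_chi_mul_chi up iota bpt pOf pOf_bijective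
  pOf_injective om chi_pOf_up chi_pOf_iota avg_om sum_chi_iota uSym_sOf_zero QsOp QsOp_mulVec)
open B5Blocks16 (bpt_bijective bpt_injective sum_blocks)
open B5Prop11Fiber (dSym d1Sym vSym uSym dSym_eq_zero_iff)
open B5Action121 (LapS GradOp sdiff sdiff_mulVec GradOp_mulVec)
open B5LaplaceInverse (lsym ssym Pker LapSinv)
open B5Momentum130 (dft_LapS_apply lsym_eq_zero_iff dft_zero_apply)
open B5Momentum133 (ssym_pOf lsym_pOf lsym_pOf_ne_zero)
open B5FiberZero (pOf_zero)
open B5Identities197Torus (RT)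
open Summit.QuantumFields.YangMills.Theorems.N07AliasSumPositivity (aliasSymbolK_pos)

/-! ## §3  Real bookkeeping: collapse of the alias sum to the support of `p′`, signed representatives, positivity (n07-w7's core BY NAME) -/

section RealSide

/-- **Collapse of a full alias sum to the support** `J = {ν | p ν}`: if off `J` the factor `f_ν` is `1` at `l_ν = 0` and `0` otherwise, and the
weight `g_ν` vanishes at `l_ν = 0`, then `Σ_{l ∈ [0,n)^d} (Π_ν f_ν(l_ν)) ∕ (Σ_ν g_ν(l_ν))² = Σ_{m ∈ [0,n)^J} (Π_{κ∈J} f_κ(m_κ)) ∕ (Σ_{κ∈J} g_κ(m_κ))²`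
(finite combinatorics: `Equiv.piEquivPiSubtypeProd`). [folklore] -/
theorem sum_collapse {d n : ℕ} [NeZero n] (p : Fin d → Prop) [DecidablePred p]
    (f g : Fin d → Fin n → ℝ)
    (hf1 : ∀ ν, ¬ p ν → f ν 0 = 1) (hf0 : ∀ ν m, ¬ p ν → m ≠ 0 → f ν m = 0) (hg0 : ∀ ν, ¬ p ν → g ν 0 = 0) :
    ∑ k : Fin d → Fin n, (∏ ν, f ν (k ν)) / (∑ ν, g ν (k ν)) ^ 2
      = ∑ a : {ν // p ν} → Fin n, (∏ κ : {ν // p ν}, f κ.1 (a κ)) / (∑ κ : {ν // p ν}, g κ.1 (a κ)) ^ 2 := by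
  rw [← (Equiv.piEquivPiSubtypeProd p (fun _ => Fin n)).symm.sum_comp, Fintype.sum_prod_type]
  refine Finset.sum_congr rfl fun a _ => ?_
  have hsymm : ∀ (b : {ν // ¬ p ν} → Fin n) (ν : Fin d),
      (Equiv.piEquivPiSubtypeProd p (fun _ => Fin n)).symm (a, b) ν = if h : p ν then a ⟨ν, h⟩ else b ⟨ν, h⟩ :=
    fun b ν => rfl
  rw [Finset.sum_eq_single (0 : {ν // ¬ p ν} → Fin n)]
  · simp_rw [hsymm]
    rw [← Fintype.prod_subtype_mul_prod_subtype p, ← Fintype.sum_subtype_add_sum_subtype p]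
    have h1 : ∏ ν : {ν // ¬ p ν}, f ν (if h : p (ν : Fin d) then a ⟨ν, h⟩ else (0 : {ν // ¬ p ν} → Fin n) ⟨ν, h⟩) = 1 :=
      Finset.prod_eq_one fun ν _ => by rw [dif_neg ν.2]; exact hf1 ν ν.2
    have h2 : ∑ ν : {ν // ¬ p ν}, g ν (if h : p (ν : Fin d) then a ⟨ν, h⟩ else (0 : {ν // ¬ p ν} → Fin n) ⟨ν, h⟩) = 0 :=
      Finset.sum_eq_zero fun ν _ => by rw [dif_neg ν.2]; exact hg0 ν ν.2
    have h3 : ∏ ν : {ν // p ν}, f ν (if h : p (ν : Fin d) then a ⟨ν, h⟩ else (0 : {ν // ¬ p ν} → Fin n) ⟨ν, h⟩)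
        = ∏ κ : {ν // p ν}, f κ.1 (a κ) :=
      Finset.prod_congr rfl fun κ _ => by rw [dif_pos κ.2]
    have h4 : ∑ ν : {ν // p ν}, g ν (if h : p (ν : Fin d) then a ⟨ν, h⟩ else (0 : {ν // ¬ p ν} → Fin n) ⟨ν, h⟩)
        = ∑ κ : {ν // p ν}, g κ.1 (a κ) :=
      Finset.sum_congr rfl fun κ _ => by rw [dif_pos κ.2]
    rw [h1, h2, mul_one, add_zero, h3, h4]
  · intro b _ hb
    obtain ⟨κ, hκ⟩ : ∃ κ, b κ ≠ 0 := Function.ne_iff.mp hb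
    rw [div_eq_zero_iff]
    left
    refine Finset.prod_eq_zero (Finset.mem_univ (κ : Fin d)) ?_
    rw [hsymm, dif_neg κ.2]
    exact hf0 κ _ κ.2 hκ
  · intro h
    exact absurd (Finset.mem_univ _) h

/-- Periodicity of the centred aliasing factor `sin(x∕2)∕(n·sin(x∕(2n)))` under `x ↦ x + 2πn` — uses that `n` is ODD (`(−1)^n = −1`). [folklore] -/
theorem phi1_periodic {n : ℕ} (hn : Odd n) (x : ℝ) :
    Real.sin ((x + 2 * Real.pi * n) / 2) / ((n : ℝ) * Real.sin ((x + 2 * Real.pi * n) / (2 * n)))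
      = Real.sin (x / 2) / ((n : ℝ) * Real.sin (x / (2 * n))) := by
  have hn0 : (n : ℝ) ≠ 0 := by exact_mod_cast hn.pos.ne'
  have e1 : (x + 2 * Real.pi * n) / 2 = x / 2 + n * Real.pi := by ring
  have e2 : (x + 2 * Real.pi * n) / (2 * n) = x / (2 * n) + Real.pi := by field_simp
  rw [e1, e2, Real.sin_add_nat_mul_pi, Real.sin_add_pi, hn.neg_one_pow]
  field_simp

/-- Periodicity of the Laplace symbol piece `Sxir n x = 4n²sin²(x∕(2n))` under `x ↦ x + 2πn`. [folklore] -/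
theorem phi2_periodic {n : ℕ} (hn0 : n ≠ 0) (x : ℝ) :
    B4Strip.Sxir n (x + 2 * Real.pi * n) = B4Strip.Sxir n x := by
  have hn0' : (n : ℝ) ≠ 0 := by exact_mod_cast hn0
  unfold B4Strip.Sxir
  have e : (x + 2 * Real.pi * n) / n = x / n + 2 * Real.pi := by field_simp
  rw [e, Real.cos_add_two_pi]

/-- **Re-indexing the signed representatives**: for `s_κ ∈ [−π,π]` put `θ_κ := s_κ` if `s_κ > 0` and `θ_κ := s_κ + 2π` otherwise; the alias sum over
`m ∈ [0,n)^J` of the centred summand at `s + 2πm` equals the same sum at `θ + 2πm` (rotate `m_κ ↦ m_κ + 1` on the coordinates with `s_κ ≤ 0`;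
the wrap-around term moves by `2πn`, under which both pieces are periodic). [folklore] -/
theorem sum_reindex {J : Type*} [Fintype J] [DecidableEq J] {n : ℕ} (hn : Odd n) (s : J → ℝ) :
    ∑ a : J → Fin n, (∏ κ, Real.sin ((s κ + 2 * Real.pi * (a κ : ℕ)) / 2) /
        ((n : ℝ) * Real.sin ((s κ + 2 * Real.pi * (a κ : ℕ)) / (2 * n)))) /
          (∑ κ, B4Strip.Sxir n (s κ + 2 * Real.pi * (a κ : ℕ))) ^ 2
      = ∑ m : J → Fin n, (∏ κ, Real.sin (((if 0 < s κ then s κ else s κ + 2 * Real.pi) + 2 * Real.pi * (m κ : ℕ)) / 2) /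
        ((n : ℝ) * Real.sin (((if 0 < s κ then s κ else s κ + 2 * Real.pi) + 2 * Real.pi * (m κ : ℕ)) / (2 * n)))) /
          (∑ κ, B4Strip.Sxir n ((if 0 < s κ then s κ else s κ + 2 * Real.pi) + 2 * Real.pi * (m κ : ℕ))) ^ 2 := by
  obtain ⟨n', rfl⟩ : ∃ n', n = n' + 1 := ⟨n - 1, by have := hn.pos; omega⟩
  -- the coordinatewise rotation
  let ρ : (J → Fin (n' + 1)) ≃ (J → Fin (n' + 1)) :=
    Equiv.piCongrRight fun κ => if 0 < s κ then Equiv.refl _ else finRotate (n' + 1)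
  rw [← ρ.sum_comp]
  refine Finset.sum_congr rfl fun m _ => ?_
  -- coordinatewise: the argument changes by `0` or by `2πn`
  have key : ∀ κ, ∃ ε : ℕ, (ε = 0 ∨ ε = 1) ∧
      (s κ + 2 * Real.pi * ((ρ m κ : Fin (n' + 1)) : ℕ)) + 2 * Real.pi * (n' + 1 : ℕ) * ε
        = (if 0 < s κ then s κ else s κ + 2 * Real.pi) + 2 * Real.pi * (m κ : ℕ) := by
    intro κ
    by_cases hκ : 0 < s κ
    · refine ⟨0, Or.inl rfl, ?_⟩
      simp [ρ, hκ]
    · simp only [ρ, Equiv.piCongrRight_apply, Pi.map_apply, if_neg hκ, finRotate_apply, Fin.val_add_one]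
      by_cases hlast : m κ = Fin.last n'
      · refine ⟨1, Or.inr rfl, ?_⟩
        rw [if_pos hlast, hlast, Fin.val_last]
        push_cast
        ring
      · refine ⟨0, Or.inl rfl, ?_⟩
        rw [if_neg hlast]
        push_cast
        ring
  have hper : ∀ κ,
      Real.sin ((s κ + 2 * Real.pi * ((ρ m κ : Fin (n' + 1)) : ℕ)) / 2) /
          (((n' + 1 : ℕ) : ℝ) * Real.sin ((s κ + 2 * Real.pi * ((ρ m κ : Fin (n' + 1)) : ℕ)) / (2 * (n' + 1 : ℕ))))
        = Real.sin (((if 0 < s κ then s κ else s κ + 2 * Real.pi) + 2 * Real.pi * (m κ : ℕ)) / 2) /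
          (((n' + 1 : ℕ) : ℝ) * Real.sin (((if 0 < s κ then s κ else s κ + 2 * Real.pi) + 2 * Real.pi * (m κ : ℕ)) / (2 * (n' + 1 : ℕ)))) ∧
      B4Strip.Sxir (n' + 1) (s κ + 2 * Real.pi * ((ρ m κ : Fin (n' + 1)) : ℕ))
        = B4Strip.Sxir (n' + 1) ((if 0 < s κ then s κ else s κ + 2 * Real.pi) + 2 * Real.pi * (m κ : ℕ)) := by
    intro κ
    obtain ⟨ε, hε, h⟩ := key κ
    rcases hε with rfl | rfl
    · simp only [Nat.cast_zero, mul_zero, add_zero] at h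
      rw [h]
      exact ⟨rfl, rfl⟩
    · rw [← h, Nat.cast_one, mul_one, phi1_periodic hn, phi2_periodic (Nat.succ_ne_zero n')]
      exact ⟨rfl, rfl⟩
  congr 1
  · exact Finset.prod_congr rfl fun κ _ => (hper κ).1
  · congr 1
    exact Finset.sum_congr rfl fun κ _ => (hper κ).2

/-- ★★ **Positivity of the signed alias sum** (dag-n07-w7's `aliasSymbolK_pos` BY NAME after `sum_reindex`): for odd `n`, a finite non-empty `J` and
`s_κ ∈ [−π,π]∖{0}`, `0 < Σ_{m} (Π_κ sin((s_κ+2πm_κ)∕2)∕(n·sin((s_κ+2πm_κ)∕(2n)))) ∕ (Σ_κ Sxir n (s_κ+2πm_κ))²` (`= n⁻⁴ ×` the positive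
`aliasSymbolK` at `θ`). [cite: Balaban1987RG1, (0.4) p.253; folklore] -/
theorem signed_alias_sum_pos {J : Type*} [Fintype J] [DecidableEq J] [Nonempty J] {n : ℕ} (hn : Odd n)
    (s : J → ℝ) (hs : ∀ κ, |s κ| ≤ Real.pi) (hs0 : ∀ κ, s κ ≠ 0) :
    0 < ∑ a : J → Fin n, (∏ κ, Real.sin ((s κ + 2 * Real.pi * (a κ : ℕ)) / 2) /
        ((n : ℝ) * Real.sin ((s κ + 2 * Real.pi * (a κ : ℕ)) / (2 * n)))) /
          (∑ κ, B4Strip.Sxir n (s κ + 2 * Real.pi * (a κ : ℕ))) ^ 2 := by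
  rw [sum_reindex hn s]
  set θ : J → ℝ := fun κ => if 0 < s κ then s κ else s κ + 2 * Real.pi with hθdef
  have hθ : ∀ κ, 0 < θ κ ∧ θ κ < 2 * Real.pi := by
    intro κ
    have h1 := abs_le.mp (hs κ)
    have h2 := hs0 κ
    have hπ := Real.pi_pos
    simp only [hθdef]
    by_cases h : 0 < s κ
    · rw [if_pos h]; constructor <;> linarith
    · rw [if_neg h]
      have h' : s κ < 0 := lt_of_le_of_ne (not_lt.mp h) h2
      constructor <;> linarith
  have hpos := aliasSymbolK_pos hn θ hθ
  have hn0 : (n : ℝ) ≠ 0 := by exact_mod_cast hn.pos.ne'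
  have hθ' : ∀ κ, (if 0 < s κ then s κ else s κ + 2 * Real.pi) = θ κ := fun κ => rfl
  simp_rw [hθ']
  have heq : ∑ m : J → Fin n, (∏ κ, Real.sin ((θ κ + 2 * Real.pi * (m κ : ℕ)) / 2) /
        ((n : ℝ) * Real.sin ((θ κ + 2 * Real.pi * (m κ : ℕ)) / (2 * n)))) /
          (∑ κ, B4Strip.Sxir n (θ κ + 2 * Real.pi * (m κ : ℕ))) ^ 2
      = ((n : ℝ) ^ 4)⁻¹ * (((n : ℝ) ^ Fintype.card J)⁻¹ *
          ∑ m : J → Fin n, (∏ κ, (-1 : ℝ) ^ (m κ : ℕ) * Real.sin (θ κ / 2) /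
              Real.sin ((θ κ + 2 * Real.pi * (m κ : ℕ)) / (2 * n))) /
            (4 * ∑ κ, Real.sin ((θ κ + 2 * Real.pi * (m κ : ℕ)) / (2 * n)) ^ 2) ^ 2) := by
    rw [Finset.mul_sum, Finset.mul_sum]
    refine Finset.sum_congr rfl fun m _ => ?_
    have hsin : ∀ κ, Real.sin ((θ κ + 2 * Real.pi * (m κ : ℕ)) / 2) = (-1 : ℝ) ^ (m κ : ℕ) * Real.sin (θ κ / 2) := by
      intro κ
      have e : (θ κ + 2 * Real.pi * (m κ : ℕ)) / 2 = θ κ / 2 + (m κ : ℕ) * Real.pi := by ring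
      rw [e, Real.sin_add_nat_mul_pi]
    simp_rw [hsin, B4Strip.Sxir_eq]
    have hden : ∏ x, (n : ℝ) * Real.sin ((θ x + 2 * Real.pi * (m x : ℕ)) / (2 * n))
        = (n : ℝ) ^ Fintype.card J * ∏ x, Real.sin ((θ x + 2 * Real.pi * (m x : ℕ)) / (2 * n)) := by
      rw [Finset.prod_mul_distrib, Finset.prod_const, Finset.card_univ]
    rw [Finset.prod_div_distrib, Finset.prod_div_distrib, hden, ← Finset.mul_sum]
    ring
  rw [heq]
  exact mul_pos (inv_pos.mpr (pow_pos (by exact_mod_cast hn.pos) 4)) hpos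

end RealSide

/-! ## §4  The centre-sampling symbol `K(p′) = Σ_l e^{i(p′+l)·ηc₀} conj u(p′+l) ∕ Δ(p′+l)²` is a POSITIVE real for `p′ ≠ 0` -/

section Symbol

variable {d : ℕ} (n : ℕ) [NeZero n] (M : Fin d → ℕ) [hM : ∀ μ, NeZero (M μ)]

/-- Per coordinate, the centred aliasing factor is the cast of an explicit real number (the three cases of §2 in one `if`).
[cite: Balaban1984PropagatorsI, (1.31) p.23, (1.61) p.28] -/
theorem factor_eq_real (c : ℕ) (hc : 2 * c + 1 = n) (k : Fin d → Fin n) (q : Tor M) (ν : Fin d) :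
    om n k (sOf M q) ν ^ c * conj (vSym n k (sOf M q) ν)
      = ((if q ν = 0 then (if k ν = 0 then (1 : ℝ) else 0) else
          Real.sin (B4Strip.shiftr n k (sOf M q) ν / 2) /
            ((n : ℝ) * Real.sin (B4Strip.shiftr n k (sOf M q) ν / (2 * n))) : ℝ) : ℂ) := by
  by_cases hq : q ν = 0
  · have hs : sOf M q ν = 0 := (sOf_apply_eq_zero_iff M q ν).mpr hq
    rw [if_pos hq]
    by_cases hk : k ν = 0
    · rw [if_pos hk, om_pow_mul_conj_vSym_zero n M c k q ν hs hk, Complex.ofReal_one]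
    · rw [if_neg hk, om_pow_mul_conj_vSym_eq_zero n M c hc k q ν hs hk, Complex.ofReal_zero]
  · have hs : sOf M q ν ≠ 0 := fun h => hq ((sOf_apply_eq_zero_iff M q ν).mp h)
    rw [if_neg hq, om_pow_mul_conj_vSym n M c hc k q ν (fun h => hs h.1)]

/-- **The summand of the centre-sampling symbol is real**: `e^{i(p′+l)·ηc₀}·conj u(p′+l)∕Δ(p′+l)²` is the cast of
`(Π_ν f_ν(l_ν)) ∕ (Σ_ν Δ_ν(p′_ν+l_ν))²` with the real factors of `factor_eq_real` and `Δ_ν = Sxir`.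
[cite: Balaban1984PropagatorsI, (1.31) p.23] -/
theorem summand_eq_real (c₀ : Fin d → Fin n) (hc₀ : ∀ ν, 2 * (c₀ ν : ℕ) + 1 = n) (q : Tor M) (k : Fin d → Fin n) :
    chi (fine n M) (pOf n M (k, q)) (iota n M c₀) * conj (uSym n k (sOf M q)) /
        lsym (fine n M) (n : ℂ) (pOf n M (k, q)) ^ 2
      = (((∏ ν, (if q ν = 0 then (if k ν = 0 then (1 : ℝ) else 0) else
            Real.sin (B4Strip.shiftr n k (sOf M q) ν / 2) /
              ((n : ℝ) * Real.sin (B4Strip.shiftr n k (sOf M q) ν / (2 * n))))) /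
          (∑ ν, B4Strip.Sxir n (B4Strip.shiftr n k (sOf M q) ν)) ^ 2 : ℝ) : ℂ) := by
  rw [chi_pOf_iota, uSym, map_prod, ← Finset.prod_mul_distrib]
  simp_rw [factor_eq_real n M _ (hc₀ _) k q]
  rw [← Complex.ofReal_prod, lsym_pOf, ← Complex.ofReal_pow, ← Complex.ofReal_div]
  congr 2
  unfold B4Strip.DeltaXir
  rw [add_zero]

/-- **THE CENTRE-SAMPLING SYMBOL DOES NOT VANISH OFF THE ZERO MODE** (odd `n = 2c₀+1`, every `d`, every torus `T₁`): for `p′ ≠ 0`,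
`K(p′) := Σ_l e^{i(p′+l)·ηc₀} · conj u(p′+l) ∕ Δ(p′+l)² ≠ 0`.  It is the cast of a real sum which, after collapsing the directions with
`p′_ν = 0` (only `l_ν = 0` survives there) and re-indexing the signed representatives `p′_ν ∈ [−π,π]` to `(0,2π)`, equals `n⁻⁴ ×`
dag-n07-w7's `aliasSymbolK`, positive by `N07AliasSumPositivity.aliasSymbolK_pos`. [cite: Balaban1984PropagatorsI, (1.31) p.23; Balaban1987RG1, (0.4) p.253] -/
theorem centreSymbol_ne_zero (c₀ : Fin d → Fin n) (hc₀ : ∀ ν, 2 * (c₀ ν : ℕ) + 1 = n) {q : Tor M} (hq : q ≠ 0) :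
    ∑ k : Fin d → Fin n, chi (fine n M) (pOf n M (k, q)) (iota n M c₀) * conj (uSym n k (sOf M q)) /
        lsym (fine n M) (n : ℂ) (pOf n M (k, q)) ^ 2 ≠ 0 := by
  classical
  simp_rw [summand_eq_real n M c₀ hc₀ q]
  rw [← Complex.ofReal_sum, Complex.ofReal_ne_zero]
  -- collapse to the support `J = {ν | q ν ≠ 0}`
  have hshift : ∀ (k : Fin d → Fin n) ν, B4Strip.shiftr n k (sOf M q) ν = sOf M q ν + 2 * Real.pi * ((k ν : ℕ) : ℝ) :=
    fun k ν => rfl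
  simp_rw [hshift]
  rw [sum_collapse (fun ν => q ν ≠ 0)
    (fun ν m => if q ν = 0 then (if m = 0 then (1 : ℝ) else 0) else
      Real.sin ((sOf M q ν + 2 * Real.pi * ((m : ℕ) : ℝ)) / 2) /
        ((n : ℝ) * Real.sin ((sOf M q ν + 2 * Real.pi * ((m : ℕ) : ℝ)) / (2 * n))))
    (fun ν m => B4Strip.Sxir n (sOf M q ν + 2 * Real.pi * ((m : ℕ) : ℝ)))]
  rotate_left
  · intro ν hν
    rw [not_not] at hν
    simp [hν]
  · intro ν m hν hm
    rw [not_not] at hν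
    simp [hν, hm]
  · intro ν hν
    rw [not_not] at hν
    rw [(sOf_apply_eq_zero_iff M q ν).mpr hν]
    simp [B4Strip.Sxir]
  -- on the support the `if` is resolved and the sum is the signed alias sum
  have hne : Nonempty {ν // q ν ≠ 0} := by
    obtain ⟨ν, hν⟩ := Function.ne_iff.mp hq
    exact ⟨⟨ν, hν⟩⟩
  have hodd : Odd n := ⟨c₀ (Classical.choice hne).1, by have := hc₀ (Classical.choice hne).1; omega⟩
  have hsum := signed_alias_sum_pos (J := {ν // q ν ≠ 0}) hodd (fun κ => sOf M q κ.1)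
    (fun κ => B5Prop11Plancherel.abs_sOf_le M q κ.1) (fun κ h => κ.2 ((sOf_apply_eq_zero_iff M q κ.1).mp h))
  refine ne_of_gt (hsum.trans_le (le_of_eq ?_))
  refine Finset.sum_congr rfl fun a _ => ?_
  congr 1
  exact Finset.prod_congr rfl fun κ _ => by rw [if_neg κ.2]

end Symbol

end Summit.QuantumFields.YangMills.BalabanUVNodes.N07PointFeasibilityOneLevel

end
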